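import Summits.BirchSwinnertonDyer.BirchSwinnertonDyer.Theorems.KatoDescentTamePotSupersingularTameUpperUnitTwistRecordToolsTamagawa
import HarnessLib

/-!
# Route `KatoDescentTamePotSupersingular` (rung K8, sub-rung B4 (t′), cell `bsd-potss`): Tamagawa TOOL, supplement — the ♯ records'
# SINGLE-CARRIER datum `ord_p Tam(E) ≤ ord_p c_q(E)` from the integer model (seat `bsd-potss-k8t-c4` g15; route-free; 0 definitions,
# 0 named facts, 0 `sorry`; closes nothing)

WHY. The ♯ unit-twist records of items 19202 / 19982 (g14, 85 rows) DISPLAY `hsingle : p ∣ Tam(E) → ∃ q, q ∥ N, q ≠ p,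
ord_p Tam(E) ≤ ord_p c_q(E)` — Jetchev's sharpening credits the p-part of ONE Tamagawa number. If every bad prime other than the
carrier `q₀` has `p ∤ c_ℓ` (the per-prime lemmas of `…RecordToolsTamagawa` and the Tate-step facts), then `ord_p Tam(E) = ord_p c_{q₀}`
(`tamagawaProduct_eq_prod`, `Finset.mul_prod_erase`, `padicValNat.mul`). This file proves the inequality form
`padicValNat_tamagawaProduct_le_of_single`, with the carrier's local number read in Mathlib's `ℚ_{q₀}`.

References: [SilvermanATAEC1994] Cor. IV.9.2, IV.9.4; [SilvermanAEC2009] C.16; [Jetchev2008] Thm. 1.1; [Cremona2006] Table 1.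
-/

set_option autoImplicit false
-- the Theorems directory repeats the summit name (sibling precedent `KatoDescentPotSupersingularAssembly.lean`)
set_option linter.dupNamespace false

noncomputable section

open scoped Classical NumberField

namespace Summit.BirchSwinnertonDyer.BirchSwinnertonDyer.Theorems.TameUpperUnitTwistRecords

open WeierstrassCurve WeierstrassCurve.Rat IsDedekindDomain Rat.HeightOneSpectrum NumberField
  Literature.NumberTheory.EllipticCurves Literature.NumberTheory.EllipticCurves.Rank1Residual
  Summit.BirchSwinnertonDyer.Rank1Residual Summit.BirchSwinnertonDyer.Rank1Residual.Additive
  Summit.BirchSwinnertonDyer.BirchSwinnertonDyer.Rank1Residual.IntModel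
  Summit.BirchSwinnertonDyer.BirchSwinnertonDyer.Rank2Observatory.RootNumber

/-- **`ord_p Tam(W) ≤ ord_p c_{q₀}(W)` when no other bad prime carries `p`.** For the globally minimal `W` with integer model `E₀`, a
complete prime factorisation `|Δ(E₀)| = ∏_{(ℓ,e) ∈ G} ℓᵉ`, a listed prime `q₀`, and `p ∤ c_ℓ` for every listed `ℓ ≠ q₀` (each in
Mathlib's `ℚ_ℓ`): `ord_p Tam(W) ≤ ord_p c_{q₀}` (in fact equality; `Tam = ∏_bad c_ℓ`, `c_ℓ ≠ 0`).
[cite: SilvermanAEC2009, C.16] [cite: SilvermanATAEC1994, Cor. IV.9.2] -/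
theorem padicValNat_tamagawaProduct_le_of_single {W : WeierstrassCurve ℚ} [W.IsElliptic] [W.IsGloballyMinimal]
    {E₀ : WeierstrassCurve ℤ} (hI : integralModelInt W = E₀) {G : List (ℕ × ℕ)}
    (hfac : E₀.Δ.natAbs = (G.map fun qe : ℕ × ℕ => qe.1 ^ qe.2).prod) (hGp : ∀ qe ∈ G, qe.1.Prime)
    {p : ℕ} (hp : p.Prime) (q₀ : ℕ) (hq₀ : q₀.Prime) (hq₀G : q₀ ∈ G.map Prod.fst)
    (hloc : ∀ qe ∈ G, qe.1 ≠ q₀ → ∀ (r : Nat.Primes), (r : ℕ) = qe.1 →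
      ¬ p ∣ (haveI := Fact.mk r.2; (W.baseChange ℚ_[r]).localTamagawaNumber ℤ_[r])) :
    haveI := Fact.mk hq₀
    padicValNat p W.tamagawaProduct ≤ padicValNat p ((W.baseChange ℚ_[q₀]).localTamagawaNumber ℤ_[q₀]) := by
  have hW : W = E₀.baseChange ℚ := by
    rw [← hI, WeierstrassCurve.baseChange, algebraMap_int_eq, map_integralModelInt]
  let c : HeightOneSpectrum ℤ → ℕ := fun v =>
    haveI := Fact.mk (primesEquiv v).2
    (W.baseChange ℚ_[primesEquiv v]).localTamagawaNumber ℤ_[primesEquiv v]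
  let S : Finset (HeightOneSpectrum ℤ) := (G.map fun qe : ℕ × ℕ => natPlace qe.1).toFinset
  have hs : ∀ v, ¬ W.HasGoodReductionAt v → v ∈ S := by
    intro v hv
    by_contra hnot
    apply hv
    have hnd : ¬ ((natGenerator v : ℕ) : ℤ) ∣ E₀.Δ := by
      intro hd
      obtain ⟨qe, hqe, hq1⟩ := List.mem_map.mp (mem_of_prime_dvd_of_natAbs_eq_prod hfac hGp (prime_natGenerator v) hd)
      apply hnot
      rw [List.mem_toFinset, List.mem_map]
      exact ⟨qe, hqe, by rw [hq1, natPlace_natGenerator]⟩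
    rw [hW]
    exact hasGoodReductionAt_of_not_dvd hnd
  have hprod : W.tamagawaProduct = ∏ v ∈ S, c v := tamagawaProduct_eq_prod W S hs
  -- the carrier's place
  have hv₀ : natPlace q₀ ∈ S := by
    obtain ⟨qe, hqe, hq⟩ := List.mem_map.mp hq₀G
    rw [List.mem_toFinset, List.mem_map]
    exact ⟨qe, hqe, by rw [hq]⟩
  have hc0 : ∀ v, c v ≠ 0 := fun v ↦ by
    haveI := Fact.mk (primesEquiv v).2
    haveI : (W.baseChange ℚ_[primesEquiv v]).IsElliptic := by unfold WeierstrassCurve.baseChange; infer_instance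
    exact localTamagawaNumber_padic_ne_zero_holds _ _
  have hrest : ¬ p ∣ ∏ v ∈ S.erase (natPlace q₀), c v := by
    intro h
    obtain ⟨v, hv, hdvd⟩ := (Prime.dvd_finsetProd_iff (Nat.prime_iff.mp hp) _).mp h
    rw [Finset.mem_erase, List.mem_toFinset, List.mem_map] at hv
    obtain ⟨hne, qe, hqe, rfl⟩ := hv
    have hne' : qe.1 ≠ q₀ := fun h ↦ hne (by rw [h])
    exact hloc qe hqe hne' (primesEquiv (natPlace qe.1)) (natGenerator_natPlace (hGp qe hqe)) hdvd
  have hrest0 : ∏ v ∈ S.erase (natPlace q₀), c v ≠ 0 := Finset.prod_ne_zero_iff.mpr fun v _ ↦ hc0 v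
  have hval : padicValNat p W.tamagawaProduct = padicValNat p (c (natPlace q₀)) := by
    haveI : Fact p.Prime := ⟨hp⟩
    rw [hprod, ← Finset.mul_prod_erase S c hv₀, padicValNat.mul (hc0 _) hrest0,
      padicValNat.eq_zero_of_not_dvd hrest, add_zero]
  -- move the carrier's factor to `ℚ_[q₀]`
  have key : ∀ r : Nat.Primes, primesEquiv (natPlace q₀) = r →
      padicValNat p W.tamagawaProduct ≤
        padicValNat p (haveI := Fact.mk r.2; (W.baseChange ℚ_[r]).localTamagawaNumber ℤ_[r]) := by
    rintro r rfl
    exact hval.le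
  exact key ⟨q₀, hq₀⟩ (Subtype.ext (natGenerator_natPlace hq₀))

end Summit.BirchSwinnertonDyer.BirchSwinnertonDyer.Theorems.TameUpperUnitTwistRecords
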